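import Mathlib
import Literature.Analysis.FluidPDE.SpaceTimeCalculus
import Literature.Analysis.FluidPDE.ClassicalSolutionCalculus
import Literature.Analysis.FluidPDE.VorticityCalculus
import Literature.Analysis.FluidPDE.LambFormCurlKernel
import Literature.Analysis.FluidPDE.HelicityDensityTransport
import Summits.NavierStokesRegularity.NavierStokesRegularity.Theorems.ThreadingFluxHorizonTowerDefs
import Summits.NavierStokesRegularity.NavierStokesRegularity.Theorems.ThreadingFluxHorizonTowerFirstLemmas
import HarnessLib

/-!
# Crux `PoloidalLiouville` (stmt-NavierStokesRegularity-1222, W1), crux idea «horizon-threading-tower»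
# (ns-idea-15): the SECOND-JET HEAD FORM `SecondJetHeadForm`, in the kernel, BY NAME

Support file (`--supports stmt-NavierStokesRegularity-1222`, helper).  Experiment cell `ns-wall-extremal`, width hand
ns-wall-eng-4 g3.  HONEST FRAME: an exact space–time identity valid for EVERY classical Navier–Stokes solution on an
open time window; it is the provable first rung of the NS-dynamics half of the tower (the planner's label (M)); the
levers `OrderTwoHorizonLaw` / `OrderTwoHorizonLawBlowdown` are NOT touched; `PoloidalLiouville` (1222) stays OPEN;
nothing here bears on NS regularity.

## Statement (`Theorems/ThreadingFluxHorizonTowerDefs.lean`, `HorizonTower.SecondJetHeadForm`, verbatim)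

For a classical NS solution `(u, p)` (`ν = 1`, no force) on an open time set `S ∋ t₀` whose slice at `t₀` is
unthreaded about `x₀` (`F(t₀, x) = ⟪curl u(t₀, x), x − x₀⟫ = 0` for all `x`),
`∂ₜ²F(t₀, x) = Loc₂[u(t₀)](x) − ⟪ω, ∇(r∂ᵣB)⟫(x)`, `B = p(t₀) + |u(t₀)|²/2`, `ω = curl u(t₀)`,
where `Loc₂` is `HorizonTower.loc2` and `r∂ᵣB = radialVirial B x₀`.

## Proof

With `ω = curl u`, `λ = u × ω`, `a = λ + Δu`, `N = curl λ + Δω`: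
* `∂ₜu = λ − ∇B + Δu` (momentum equation + Lamb form `(u·∇)u = ω × u + ∇(|u|²/2)`,
  `Literature…convect_self_eq_cross_curl_add_gradient`);
* `∂ₜω = curl ∂ₜu = curl λ + Δω = N` (exchange of `∂ₜ` with `curl` for jointly smooth fields on an open time set,
  `IsSmoothSpaceTimeOn.hasDerivAt_fderiv_slice_clm`; `curl ∇ = 0`, `curl Δ = Δ curl`);
* `∂ₜλ = ∂ₜu × ω + u × N` (bilinear product rule);
* `∂ₜN = curl ∂ₜλ + Δ ∂ₜω = curl(a × ω) − curl(∇B × ω) + curl(u × N) + ΔN` (exchange of `∂ₜ` with `curl` and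
  with `Δ`, the latter through `Δ = Σᵢ ∂ᵢ∂ᵢ`);
* `⟪y, curl(∇B × ω)⟫ = ⟪ω, ∇((y·∇)B)⟫` is `HorizonTower.headVirialIdentity` (p661847; tangency = the hypothesis,
  `div curl = 0`);
* `∂ₜ²F(t₀, x) = ⟪∂ₜN(t₀, x), y⟫` because `∂ₜF = ⟪N, y⟫` on the neighbourhood `S` of `t₀`.

## References
* planner ns-idea-15, `Cruxes/PoloidalLiouville/HorizonTowerSketch.lean` (statement `SecondJetHeadForm`).
* A. J. Majda, A. L. Bertozzi, *Vorticity and Incompressible Flow* (CUP 2002), §1.1 (vector identities), §2.1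
  (vorticity equation). [MajdaBertozziCUP2002]
-/

-- the summit and its single problem share the name (D-0017 nested layout)
set_option linter.dupNamespace false

noncomputable section

namespace Summit.NavierStokesRegularity.NavierStokesRegularity.Theorems.PoloidalLiouville.HorizonTower

open Set Function Filter Topology
open scoped Topology RealInnerProductSpace Laplacian ContDiff
open Literature.Analysis.FluidPDE

/-! ### Exchange of `∂ₜ` with `curl` and with `Δ` for jointly smooth fields on an open time set -/

/-- **`∂ₜ curl = curl ∂ₜ`.**  For a field `w` jointly smooth on an open time set `S ∋ t`, the time line
`s ↦ curl (w s) x` has derivative `curl (∂ₜw(t, ·)) x` at `t`. -/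
theorem hasDerivAt_curl_slice {S : Set ℝ} {w : ℝ → E3 → E3} (h : IsSmoothSpaceTimeOn S w) (hS : IsOpen S)
    {t : ℝ} (ht : t ∈ S) (x : E3) :
    HasDerivAt (fun s => curl (w s) x) (curl (fun y => deriv (fun s => w s y) t) x) t := by
  have e : (fun s => curl (w s) x) = (⇑curlCLM ∘ fun s => fderiv ℝ (w s) x) := rfl
  rw [e, curl_eq_curlCLM]
  exact curlCLM.hasFDerivAt.comp_hasDerivAt t (h.hasDerivAt_fderiv_slice_clm hS ht x)

/-- **`∂ₜ Δ = Δ ∂ₜ`.**  For a field `w` jointly smooth on an open time set `S ∋ t`, the time line `s ↦ Δ (w s) x`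
has derivative `Δ (∂ₜw(t, ·)) x` at `t` (`Δ = Σᵢ ∂ᵢ∂ᵢ` and two exchanges of `∂ₜ` with a spatial partial
derivative, Schwarz). -/
theorem hasDerivAt_laplacian_slice {F : Type*} [NormedAddCommGroup F] [InnerProductSpace ℝ F]
    {S : Set ℝ} {w : ℝ → E3 → F} (h : IsSmoothSpaceTimeOn S w)
    (hS : IsOpen S) {t : ℝ} (ht : t ∈ S) (x : E3) :
    HasDerivAt (fun s => (Δ (w s)) x) ((Δ (fun y => deriv (fun s => w s y) t)) x) t := by
  set b := stdOrthonormalBasis ℝ E3 with hb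
  -- the fields `∂ᵢ w`
  have h1 : ∀ i, IsSmoothSpaceTimeOn S (fun s y => fderiv ℝ (w s) y (b i)) := fun i =>
    h.isSmoothSpaceTimeOn_fderiv_apply hS (b i)
  -- time derivative of `s ↦ ∂ᵢ∂ᵢ w(s, x)`
  have h2 : ∀ i, HasDerivAt (fun s => fderiv ℝ (fun y => fderiv ℝ (w s) y (b i)) x (b i))
      (fderiv ℝ (fun y => fderiv ℝ (fun z => deriv (fun s => w s z) t) y (b i)) x (b i)) t := by
    intro i
    have h3 := (h1 i).hasDerivAt_fderiv_slice hS ht x (b i)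
    have hfun : (fun y => deriv (fun s => fderiv ℝ (w s) y (b i)) t)
        = fun y => fderiv ℝ (fun z => deriv (fun s => w s z) t) y (b i) :=
      funext fun y => h.deriv_fderiv_slice_eq_fderiv_deriv hS ht y (b i)
    refine h3.congr_deriv ?_
    rw [hfun]
  have hsum := HasDerivAt.fun_sum (u := Finset.univ) fun i _ => h2 i
  -- identify the function near `t` and the value with Laplacians
  have hev : (fun s => (Δ (w s)) x) =ᶠ[𝓝 t]
      fun s => ∑ i ∈ Finset.univ, fderiv ℝ (fun y => fderiv ℝ (w s) y (b i)) x (b i) := by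
    filter_upwards [hS.mem_nhds ht] with s hs
    exact laplacian_eq_sum_fderiv_fderiv b (contDiff_infty.1 (h.contDiff_slice hs) 2) x
  have hval : ∑ i ∈ Finset.univ, fderiv ℝ (fun y => fderiv ℝ (fun z => deriv (fun s => w s z) t) y (b i)) x (b i)
      = (Δ (fun y => deriv (fun s => w s y) t)) x := by
    have hd : ContDiff ℝ 2 (fun y => deriv (fun s => w s y) t) :=
      contDiff_infty.1 ((h.isSmoothSpaceTimeOn_deriv hS).contDiff_slice ht) 2
    exact (laplacian_eq_sum_fderiv_fderiv b hd x).symm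
  rw [← hval]
  exact hsum.congr_of_eventuallyEq hev

/-- Product rule in time for the cross product of two time lines. -/
theorem hasDerivAt_cross_line {f g : ℝ → E3} {f' g' : E3} {t : ℝ} (hf : HasDerivAt f f' t)
    (hg : HasDerivAt g g' t) :
    HasDerivAt (fun s => cross (f s) (g s)) (cross (f t) g' + cross f' (g t)) t := by
  have := crossCLM.hasDerivAt_of_bilinear (u := f) (v := g) (fun _ => hf) (fun _ => hg)
  simpa only [crossCLM_apply] using this

/-- `D(v × w)` exists where `v`, `w` are differentiable. -/
theorem differentiableAt_cross {v w : E3 → E3} {x : E3} (hv : DifferentiableAt ℝ v x)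
    (hw : DifferentiableAt ℝ w x) : DifferentiableAt ℝ (fun y => cross (v y) (w y)) x :=
  (hasFDerivAt_cross hv.hasFDerivAt hw.hasFDerivAt).differentiableAt

/-! ### The classical solution: smoothness of the derived fields -/

section Solution

variable {S : Set ℝ} {u : ℝ → E3 → E3} {p : ℝ → E3 → ℝ}

/-- The vorticity `(t, x) ↦ curl u(t) x` is jointly smooth on an open time set. -/
theorem isSmoothSpaceTimeOn_curl (hu : IsSmoothSpaceTimeOn S u) (hS : IsOpen S) :
    IsSmoothSpaceTimeOn S (fun t x => curl (u t) x) := by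
  have e : (fun t x => curl (u t) x) = fun t x => curlCLM (fderiv ℝ (u t) x) := rfl
  rw [e]
  exact (hu.isSmoothSpaceTimeOn_fderiv_of_isOpen hS).clm curlCLM

/-- Cross products of jointly smooth fields are jointly smooth. -/
theorem isSmoothSpaceTimeOn_cross {v w : ℝ → E3 → E3} (hv : IsSmoothSpaceTimeOn S v)
    (hw : IsSmoothSpaceTimeOn S w) : IsSmoothSpaceTimeOn S (fun t x => cross (v t x) (w t x)) := by
  have e : (fun t x => cross (v t x) (w t x)) = fun t x => crossCLM (v t x) (w t x) := rfl
  rw [e]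
  exact (hv.clm crossCLM).clm_apply hw

/-- The Lamb vector `(t, x) ↦ u × curl u` is jointly smooth on an open time set. -/
theorem isSmoothSpaceTimeOn_lamb (hu : IsSmoothSpaceTimeOn S u) (hS : IsOpen S) :
    IsSmoothSpaceTimeOn S (fun t x => cross (u t x) (curl (u t) x)) :=
  isSmoothSpaceTimeOn_cross hu (isSmoothSpaceTimeOn_curl hu hS)

/-- The Bernoulli head `(t, x) ↦ p + |u|²/2` is jointly smooth. -/
theorem isSmoothSpaceTimeOn_head (hu : IsSmoothSpaceTimeOn S u) (hp : IsSmoothSpaceTimeOn S p) :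
    IsSmoothSpaceTimeOn S (fun t x => head (u t) (p t) x) := by
  unfold head
  exact ContDiffOn.add hp ((ContDiffOn.norm_sq ℝ hu).div_const _)

/-- `⟪T₁ − H + T₂ + T₃, y⟫ = ⟪y, T₁ + T₂ + T₃⟫ − ⟪y, H⟫` (bookkeeping for the final assembly). -/
theorem inner_rearrange (T₁ T₂ T₃ H y : E3) :
    inner ℝ (T₁ - H + T₂ + T₃) y = inner ℝ y (T₁ + T₂ + T₃) - inner ℝ y H := by
  rw [← inner_sub_right, real_inner_comm]
  congr 1
  abel

/-! ### The classical solution: the time derivatives of `u`, `ω = curl u`, `λ = u × ω`, `N = curl λ + Δω` -/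

/-- **Momentum equation in Lamb form.**  For a classical NS solution (`ν = 1`, no force) on an open time set,
`∂ₜu = u × ω − ∇(p + |u|²/2) + Δu` pointwise on `S × ℝ³`. -/
theorem deriv_velocity_eq (hS : IsOpen S) (hsol : IsClassicalNSSolutionOn S 1 0 u p) {t : ℝ}
    (ht : t ∈ S) (x : E3) :
    deriv (fun s => u s x) t
      = cross (u t x) (curl (u t) x) - gradient (head (u t) (p t)) x + (Δ (u t)) x := by
  have hmom := hsol.momentum t ht x
  simp only [timeDerivWithin_eq_deriv hS ht, one_smul, Pi.zero_apply, add_zero] at hmom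
  have hud : DifferentiableAt ℝ (u t) x :=
    ((hsol.contDiff_velocity ht).differentiable (by simp)) x
  have hpd : DifferentiableAt ℝ (p t) x :=
    ((hsol.contDiff_pressure ht).differentiable (by simp)) x
  have hnd : DifferentiableAt ℝ (fun y => ‖u t y‖ ^ 2 / 2) x :=
    (hasFDerivAt_half_norm_sq hud).differentiableAt
  -- `∇(p + |u|²/2) = ∇p + ∇(|u|²/2)` (tree: `tautLoopSplit_gradient_add`, inlined to keep the imports light)
  have hgrad : gradient (head (u t) (p t)) x
      = gradient (p t) x + gradient (fun y => ‖u t y‖ ^ 2 / 2) x := by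
    unfold head
    simp only [gradient, fderiv_fun_add hpd hnd, map_add]
  -- `ω × u = −(u × ω)` (tree: `NetFlux.cross_swap`, inlined)
  have hswap : cross (curl (u t) x) (u t x) = -cross (u t x) (curl (u t) x) := by
    simp only [cross, ← cross_anticomm (WithLp.ofLp (u t x)) (WithLp.ofLp (curl (u t) x)), WithLp.toLp_neg]
  rw [convect_self_eq_cross_curl_add_gradient hud, hswap] at hmom
  rw [hgrad, eq_sub_of_add_eq hmom]
  abel

/-- **Vorticity equation in Lamb form**: `∂ₜω = curl(u × ω) + Δω` pointwise on `S × ℝ³` (exchange `∂ₜ curl = curl ∂ₜ`,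
`curl ∇ = 0`, `curl Δ = Δ curl`). -/
theorem hasDerivAt_vorticity (hS : IsOpen S) (hsol : IsClassicalNSSolutionOn S 1 0 u p) {t : ℝ}
    (ht : t ∈ S) (x : E3) :
    HasDerivAt (fun s => curl (u s) x)
      (curl (fun w => cross (u t w) (curl (u t) w)) x + (Δ (curl (u t))) x) t := by
  have hu := hsol.smooth_velocity
  have h1 := hasDerivAt_curl_slice hu hS ht x
  have hfun : (fun y => deriv (fun s => u s y) t)
      = fun y => cross (u t y) (curl (u t) y) - gradient (head (u t) (p t)) y + (Δ (u t)) y :=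
    funext fun y => deriv_velocity_eq hS hsol ht y
  rw [hfun] at h1
  refine h1.congr_deriv ?_
  have hut : ContDiff ℝ ∞ (u t) := hsol.contDiff_velocity ht
  have hlam : ContDiff ℝ ∞ (fun y => cross (u t y) (curl (u t) y)) :=
    (isSmoothSpaceTimeOn_lamb hu hS).contDiff_slice ht
  have hB : ContDiff ℝ ∞ (head (u t) (p t)) :=
    (isSmoothSpaceTimeOn_head hu hsol.smooth_pressure).contDiff_slice ht
  have hgB : ContDiff ℝ ∞ (gradient (head (u t) (p t))) :=
    ((isSmoothSpaceTimeOn_head hu hsol.smooth_pressure).gradient hS.uniqueDiffOn).contDiff_slice ht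
  have hΔ : ContDiff ℝ ∞ (Δ (u t)) := (hu.laplacian hS.uniqueDiffOn).contDiff_slice ht
  have d1 : DifferentiableAt ℝ (fun y => cross (u t y) (curl (u t) y)) x := (hlam.differentiable (by simp)) x
  have d2 : DifferentiableAt ℝ (gradient (head (u t) (p t))) x := (hgB.differentiable (by simp)) x
  have d3 : DifferentiableAt ℝ (Δ (u t)) x := (hΔ.differentiable (by simp)) x
  rw [curl_add (d1.fun_sub d2) d3, curl_sub d1 d2, curl_gradient_eq_zero_holds _ (contDiff_infty.1 hB 2) x,
    curl_laplacian (contDiff_infty.1 hut 3) x, sub_zero]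

/-- **`∂ₜ(u × ω) = ∂ₜu × ω + u × ∂ₜω`** with `∂ₜu`, `∂ₜω` from the two equations above. -/
theorem hasDerivAt_lamb (hS : IsOpen S) (hsol : IsClassicalNSSolutionOn S 1 0 u p) {t : ℝ}
    (ht : t ∈ S) (x : E3) :
    HasDerivAt (fun s => cross (u s x) (curl (u s) x))
      (cross (u t x) (curl (fun w => cross (u t w) (curl (u t) w)) x + (Δ (curl (u t))) x)
        + cross (cross (u t x) (curl (u t) x) - gradient (head (u t) (p t)) x + (Δ (u t)) x)
            (curl (u t) x)) t := by
  have hU : HasDerivAt (fun s => u s x)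
      (cross (u t x) (curl (u t) x) - gradient (head (u t) (p t)) x + (Δ (u t)) x) t := by
    rw [← deriv_velocity_eq hS hsol ht x]
    exact hsol.smooth_velocity.hasDerivAt_timeLine hS ht x
  exact hasDerivAt_cross_line hU (hasDerivAt_vorticity hS hsol ht x)

/-- **The second time derivative of the vorticity**: with `ω = curl u`, `λ = u × ω`, `a = λ + Δu`, `B = p + |u|²/2`,
`N = curl λ + Δω = ∂ₜω`:  `∂ₜN = curl(a × ω) − curl(∇B × ω) + curl(u × N) + ΔN` pointwise on `S × ℝ³`. -/
theorem hasDerivAt_vorticityRate (hS : IsOpen S) (hsol : IsClassicalNSSolutionOn S 1 0 u p) {t : ℝ}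
    (ht : t ∈ S) (x : E3) :
    HasDerivAt (fun s => curl (fun w => cross (u s w) (curl (u s) w)) x + (Δ (curl (u s))) x)
      (curl (fun z => cross (cross (u t z) (curl (u t) z) + (Δ (u t)) z) (curl (u t) z)) x
        - curl (fun z => cross (gradient (head (u t) (p t)) z) (curl (u t) z)) x
        + curl (fun z => cross (u t z)
            (curl (fun w => cross (u t w) (curl (u t) w)) z + (Δ (curl (u t))) z)) x
        + (Δ (fun z => curl (fun w => cross (u t w) (curl (u t) w)) z + (Δ (curl (u t))) z)) x) t := by
  have hu := hsol.smooth_velocity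
  have hlamST := isSmoothSpaceTimeOn_lamb hu hS
  have hωST := isSmoothSpaceTimeOn_curl hu hS
  -- first summand: `s ↦ curl λ(s) x`
  have h1 := hasDerivAt_curl_slice hlamST hS ht x
  have hfun1 : (fun y => deriv (fun s => cross (u s y) (curl (u s) y)) t)
      = fun y => (cross (cross (u t y) (curl (u t) y) + (Δ (u t)) y) (curl (u t) y)
          - cross (gradient (head (u t) (p t)) y) (curl (u t) y))
          + cross (u t y) (curl (fun w => cross (u t w) (curl (u t) w)) y + (Δ (curl (u t))) y) := by
    -- `(a − g) × w = a × w − g × w` (tree: `NetFlux.cross_sub_left'`, inlined)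
    have hcs : ∀ a g w : E3, cross (a - g) w = cross a w - cross g w := fun a g w => by
      simp only [← crossCLM_apply, map_sub, sub_apply]
    funext y
    rw [(hasDerivAt_lamb hS hsol ht y).deriv, add_comm, sub_add_eq_add_sub, hcs]
  rw [hfun1] at h1
  -- second summand: `s ↦ Δ ω(s) x`
  have h2 := hasDerivAt_laplacian_slice hωST hS ht x
  have hfun2 : (fun y => deriv (fun s => curl (u s) y) t)
      = fun y => curl (fun w => cross (u t w) (curl (u t) w)) y + (Δ (curl (u t))) y :=
    funext fun y => (hasDerivAt_vorticity hS hsol ht y).deriv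
  rw [hfun2] at h2
  refine (h1.add h2).congr_deriv ?_
  -- split the curl of the first slice
  have hut : ContDiff ℝ ∞ (u t) := hsol.contDiff_velocity ht
  have hω : ContDiff ℝ ∞ (fun y => curl (u t) y) := hωST.contDiff_slice ht
  have hlam : ContDiff ℝ ∞ (fun y => cross (u t y) (curl (u t) y)) := hlamST.contDiff_slice ht
  have hgB : ContDiff ℝ ∞ (gradient (head (u t) (p t))) :=
    ((isSmoothSpaceTimeOn_head hu hsol.smooth_pressure).gradient hS.uniqueDiffOn).contDiff_slice ht
  have hΔ : ContDiff ℝ ∞ (Δ (u t)) := (hu.laplacian hS.uniqueDiffOn).contDiff_slice ht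
  have hcl : ContDiff ℝ ∞ (fun y => curl (fun w => cross (u t w) (curl (u t) w)) y) :=
    (isSmoothSpaceTimeOn_curl hlamST hS).contDiff_slice ht
  have hΔω : ContDiff ℝ ∞ (Δ (curl (u t))) := (hωST.laplacian hS.uniqueDiffOn).contDiff_slice ht
  have du : DifferentiableAt ℝ (u t) x := (hut.differentiable (by simp)) x
  have dω : DifferentiableAt ℝ (fun y => curl (u t) y) x := (hω.differentiable (by simp)) x
  have d1 : DifferentiableAt ℝ (fun y => cross (u t y) (curl (u t) y)) x := (hlam.differentiable (by simp)) x
  have d2 : DifferentiableAt ℝ (gradient (head (u t) (p t))) x := (hgB.differentiable (by simp)) x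
  have d3 : DifferentiableAt ℝ (Δ (u t)) x := (hΔ.differentiable (by simp)) x
  have dN : DifferentiableAt ℝ
      (fun y => curl (fun w => cross (u t w) (curl (u t) w)) y + (Δ (curl (u t))) y) x :=
    ((hcl.differentiable (by simp)) x).fun_add ((hΔω.differentiable (by simp)) x)
  have dA : DifferentiableAt ℝ
      (fun y => cross (cross (u t y) (curl (u t) y) + (Δ (u t)) y) (curl (u t) y)) x :=
    differentiableAt_cross (d1.fun_add d3) dω
  have dB : DifferentiableAt ℝ (fun y => cross (gradient (head (u t) (p t)) y) (curl (u t) y)) x :=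
    differentiableAt_cross d2 dω
  have dC : DifferentiableAt ℝ (fun y => cross (u t y)
      (curl (fun w => cross (u t w) (curl (u t) w)) y + (Δ (curl (u t))) y)) x :=
    differentiableAt_cross du dN
  rw [curl_add (dA.fun_sub dB) dC, curl_sub dA dB]

end Solution

/-! ### The theorem -/

/-- **SECOND-JET HEAD FORM** (`HorizonTower.SecondJetHeadForm`, BY NAME): for a classical NS solution (`ν = 1`, no force)
on an open time window `S ∋ t₀` whose slice at `t₀` is unthreaded about `x₀` (`F(t₀, ·) ≡ 0`,
`F(t, x) = ⟪curl u(t) x, x − x₀⟫`),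
`∂ₜ²F(t₀, x) = Loc₂[u(t₀)](x) − ⟪ω, ∇(r∂ᵣB)⟫`, `B = p(t₀) + |u(t₀)|²/2` — the pressure enters the order-two
threading coefficient only through the radial virial of the head along vortex lines.  Movement on
`PoloidalLiouville` (1222): none; this is an identity for every classical solution.
[cite: MajdaBertozziCUP2002, §1.1 (vector identities), §2.1 (vorticity equation)] -/
theorem secondJetHeadForm : SecondJetHeadForm := by
  intro S u p x₀ t₀ hS ht₀ hsol hF x
  have hu := hsol.smooth_velocity
  -- `∂ₜF = ⟪N, y⟫` on `S`, hence near `t₀`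
  have hdF : ∀ s ∈ S, HasDerivAt (fun τ => threadingFlux u x₀ τ x)
      (inner ℝ (curl (fun w => cross (u s w) (curl (u s) w)) x + (Δ (curl (u s))) x) (x - x₀)) s := by
    intro s hs
    have h := (hasDerivAt_vorticity hS hsol hs x).inner (𝕜 := ℝ) (hasDerivAt_const s (x - x₀))
    simpa [threadingFlux, inner_zero_right] using h
  have hderiv : deriv (fun τ => threadingFlux u x₀ τ x) =ᶠ[𝓝 t₀]
      fun s => inner ℝ (curl (fun w => cross (u s w) (curl (u s) w)) x + (Δ (curl (u s))) x) (x - x₀) := by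
    filter_upwards [hS.mem_nhds ht₀] with s hs using (hdF s hs).deriv
  -- `∂ₜ²F(t₀, x) = ⟪∂ₜN(t₀, x), y⟫`
  have h2 := ((hasDerivAt_vorticityRate hS hsol ht₀ x).inner (𝕜 := ℝ) (hasDerivAt_const t₀ (x - x₀))).deriv
  rw [inner_zero_right, zero_add] at h2
  have hit : iteratedDeriv 2 (fun τ => threadingFlux u x₀ τ x) t₀
      = deriv (deriv fun τ => threadingFlux u x₀ τ x) t₀ := by
    rw [iteratedDeriv_succ, iteratedDeriv_one]
  rw [hit, hderiv.deriv_eq, h2]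
  -- the head term: head–virial identity at `t₀` (tangency = the hypothesis, `div curl = 0`)
  have hut : ContDiff ℝ ∞ (u t₀) := hsol.contDiff_velocity ht₀
  have hu2 : ContDiff ℝ 2 (u t₀) := contDiff_infty.1 hut 2
  have hω1 : ContDiff ℝ 1 (curl (u t₀)) := contDiff_curl (n := 1) (by exact_mod_cast hu2)
  have hB2 : ContDiff ℝ 2 (head (u t₀) (p t₀)) :=
    contDiff_infty.1 ((isSmoothSpaceTimeOn_head hu hsol.smooth_pressure).contDiff_slice ht₀) 2
  have htan : ∀ z, inner ℝ (curl (u t₀) z) (z - x₀) = 0 := fun z => hF z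
  have hdiv : VectorCalculus.IsDivFree (curl (u t₀)) := fun z =>
    HelicityDensityTransport.divergence_curl_eq_zero_of_contDiffAt hu2.contDiffAt
  have hhv := headVirialIdentity (curl (u t₀)) (head (u t₀) (p t₀)) x₀ hω1 hB2 htan hdiv x
  unfold loc2 radialVirial
  rw [← hhv]
  exact inner_rearrange _ _ _ _ _

end Summit.NavierStokesRegularity.NavierStokesRegularity.Theorems.PoloidalLiouville.HorizonTower

end
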